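import Summits.QuantumFields.YangMills.Theorems.UnitScaleTiltProp7QH1OfSectors
import Summits.QuantumFields.YangMills.Theorems.UnitScaleTiltProp7QTwSectors
import Summits.QuantumFields.YangMills.Theorems.UnitScaleTiltProp7DivSliceOfMemberDivSq
import HarnessLib

/-!
# Route `UnitScaleTilt`, crux K1 «MinimiserStabilityRegPr» (stmt-QuantumFields-19200), LANE II, row (QH1)♮ — companion of ✓`Prop7QH1OfSectors`:
# **`hHsplit` FOR THE DOOR'S LETTER `H f := c₀L·ℓ²·CURL_HS f + ‖D*_W f‖²`, BY NAME FROM ★px10's SECTOR ROWS ✓`Prop7QTwSectors`**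

Cell `ym3-torus`, width seat `ym3-torus-px21` (gen 8; LOCATE `LOCATE-QH1-SECTORS-px21g8.md` ea3b0d6b75d161ee, point 5; v2 = re-cut over ★px10 g5's (9) per the bus 12:1xZ).
THEOREMS ONLY (0 `def`, 0 `sorry`); `--supports stmt-QuantumFields-19200 --as helper`, count-neutral.  YM₃ on T³ is a ladder rung (R3), not d = 4, not infinite volume, not the
Clay problem; nothing here claims the stub, the crux, `hN06`, (QH1), (QB) or the mass gap.

THE POINT.  ✓`Prop7QH1OfSectors.hQH1_of_sectors` (the EX display's `hQH1` traded for {`hHsplit`, `h𝔰𝔲`, `hcen`}) carries the sector sub-additivity `hHsplit` of the free letter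
`H`.  For the lane-II door's letter (★p1 g19, 2026-08-29 09:50Z) `H f := c₀L·ℓ²·CURL_HS f + ‖D*_W f‖²` both summands split with EQUALITY over `M₂(ℂ) = 𝔰𝔲(2) ⊕ I•𝔰𝔲(2) ⊕ ℂ•1`:
`CURL_HS` per plaquette by ★px10's ✓`Prop7QTwSectors.sum_normSq_curl_entries_sectors_member`, and `‖D*_W ·‖² = c₀·ℓ²·DIV_HS` (✓`Prop7DivSliceOfMemberDivSq.norm_sq_DstarL2_toL2_eq`) per
site by ✓`Prop7QTwSectors.sum_normSq_divB_entries_sectors_member`.  This file only sums those rows and states the result in `hHsplit`'s binder text.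

WHAT IS PROVED (ns `…Theorems.Prop7QH1SectorRowsOfH`):
* §1 `curlHS_sector_split_member` (the summed `Σ_x Σ_μ Σ_ν (if μ<ν …)` form), `normSq_DstarL2_sector_split` — equalities, hypotheses in the leg lemma's form (`∈ skewAdjoint`, `trace = 0`).
* §2 ★★ `hHsplit_doorH (c₀) : ⟨✓`hQH1_of_sectors`'s `hHsplit` binder⟩` at `H := fun F n K W f ↦ c₀ F.L·((F.L:ℝ)^(K−n))²·CURL_HS W (toL2⁻¹ f) + ‖DstarL2 F n K (c₀ F.L) W f‖²` — `≤` by `=`;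
  `hH0_doorH (c₀)` — the display's `hH0` letter at the same `H` (sum of squares); `doorH_toL2_eq` — `H_door (toL2 A) = c₀L·ℓ²·(CURL_HS_W(A) + DIV_HS_W(A))`.
HONEST SCOPE.  A by-name knit; the sector rows are ★px10's, the dictionary is ✓`norm_sq_DstarL2_toL2_eq`; (QH1) itself is NOT proved here.

References: T. Bałaban, CMP **99** (1985) 389–434 [Balaban1985BackgroundPropagators] ((3.4) p.391, (3.8)–(3.11) p.392); CMP **102** (1985) 277–309 [Balaban1985Variational]
((14) p.280, (51) p.286).
-/

set_option autoImplicit false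

noncomputable section

open scoped BigOperators Matrix.Norms.L2Operator Matrix InnerProductSpace ComplexConjugate

namespace Summit.QuantumFields.YangMills.Theorems.Prop7QH1SectorRowsOfH

open Literature.MathematicalPhysics.QuantumFieldTheory.Balaban1983to89
open Literature.MathematicalPhysics.QuantumFieldTheory.Balaban1983to89.T3ContinuumYM3Torus
open B9TorusCalculus (torusT)
open B9Eq39Adjoint (curl divB)
open B10Eq27TorusAxialLog (unitsField toUField)
open B11Eq103H1Complex (BondL2K)
open Summit.QuantumFields.YangMills.Theorems.Prop7SectET3Transport (periodsT3)
open Summit.QuantumFields.YangMills.Theorems.Prop7SectET3HilbertLetters (W₂ toL2 DstarL2)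
open Summit.QuantumFields.YangMills.Theorems.Prop7QTwSectors (sum_normSq_curl_entries_sectors_member sum_normSq_divB_entries_sectors_member)
open Summit.QuantumFields.YangMills.Theorems.Prop7DivSliceOfMemberDivSq (norm_sq_DstarL2_toL2_eq)

/-! ## §1 The two summands of the door's `H`, split over the sectors (summed forms of ★px10's rows) -/

section Rows

variable {F : T3Family} {K : ℕ}

/-- **`CURL_HS` SPLITS OVER THE THREE SECTORS (EQUALITY), SUMMED FORM** — ✓`sum_normSq_curl_entries_sectors_member` under `Σ_x Σ_μ Σ_ν (if μ < ν …)`; hypotheses in the leg lemma's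
form. [cite: Balaban1985BackgroundPropagators, (3.4) p.391, (3.11) p.392] -/
theorem curlHS_sector_split_member (W : GaugeField (F.P K) 0 (Matrix.specialUnitaryGroup (Fin 2) ℂ))
    {S T : PBond (F.P K) 0 → Matrix (Fin 2) (Fin 2) ℂ} (τ : PBond (F.P K) 0 → ℂ)
    (hS : ∀ b, S b ∈ skewAdjoint (Matrix (Fin 2) (Fin 2) ℂ)) (hS0 : ∀ b, (S b).trace = 0)
    (hT : ∀ b, T b ∈ skewAdjoint (Matrix (Fin 2) (Fin 2) ℂ)) (hT0 : ∀ b, (T b).trace = 0) :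
    (∑ x : Site (F.P K) 0, ∑ μ : Fin (F.P K).d, ∑ ν : Fin (F.P K).d, (if μ < ν then ∑ j : Fin 2, ∑ k : Fin 2,
        ‖(curl (torusT (F.P K) 0) (fun κ z => unitsField (toUField W) ⟨z, κ⟩)
          (fun κ z => S ⟨z, κ⟩ + Complex.I • T ⟨z, κ⟩ + τ ⟨z, κ⟩ • (1 : Matrix (Fin 2) (Fin 2) ℂ)) μ ν x) j k‖ ^ 2 else 0))
      = (∑ x : Site (F.P K) 0, ∑ μ : Fin (F.P K).d, ∑ ν : Fin (F.P K).d, (if μ < ν then ∑ j : Fin 2, ∑ k : Fin 2,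
            ‖(curl (torusT (F.P K) 0) (fun κ z => unitsField (toUField W) ⟨z, κ⟩) (fun κ z => S ⟨z, κ⟩) μ ν x) j k‖ ^ 2 else 0))
        + (∑ x : Site (F.P K) 0, ∑ μ : Fin (F.P K).d, ∑ ν : Fin (F.P K).d, (if μ < ν then ∑ j : Fin 2, ∑ k : Fin 2,
            ‖(curl (torusT (F.P K) 0) (fun κ z => unitsField (toUField W) ⟨z, κ⟩) (fun κ z => T ⟨z, κ⟩) μ ν x) j k‖ ^ 2 else 0))
        + (∑ x : Site (F.P K) 0, ∑ μ : Fin (F.P K).d, ∑ ν : Fin (F.P K).d, (if μ < ν then ∑ j : Fin 2, ∑ k : Fin 2,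
            ‖(curl (torusT (F.P K) 0) (fun κ z => unitsField (toUField W) ⟨z, κ⟩)
              (fun κ z => τ ⟨z, κ⟩ • (1 : Matrix (Fin 2) (Fin 2) ℂ)) μ ν x) j k‖ ^ 2 else 0)) := by
  have hS' : ∀ b, star (S b) = -S b ∧ (S b).trace = 0 := fun b => ⟨skewAdjoint.mem_iff.1 (hS b), hS0 b⟩
  have hT' : ∀ b, star (T b) = -T b ∧ (T b).trace = 0 := fun b => ⟨skewAdjoint.mem_iff.1 (hT b), hT0 b⟩
  rw [← Finset.sum_add_distrib, ← Finset.sum_add_distrib]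
  refine Finset.sum_congr rfl fun x _ => ?_
  rw [← Finset.sum_add_distrib, ← Finset.sum_add_distrib]
  refine Finset.sum_congr rfl fun μ _ => ?_
  rw [← Finset.sum_add_distrib, ← Finset.sum_add_distrib]
  refine Finset.sum_congr rfl fun ν _ => ?_
  split_ifs with hμν
  · exact sum_normSq_curl_entries_sectors_member F W S T hS' hT' τ μ ν x
  · simp

/-- **`‖D*_W f‖²` SPLITS OVER THE THREE SECTORS (EQUALITY)** — `‖D*_W (toL2 X)‖² = c₀·ℓ²·DIV_HS(X)` (✓`norm_sq_DstarL2_toL2_eq`) and ✓`sum_normSq_divB_entries_sectors_member` per site.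
[cite: Balaban1985BackgroundPropagators, (3.8) p.392, (3.11) p.392] -/
theorem normSq_DstarL2_sector_split {n : ℕ} {c₀ : ℝ} [Fact (0 < c₀)] (W : GaugeField (F.P K) 0 (Matrix.specialUnitaryGroup (Fin 2) ℂ))
    {S T : PBond (F.P K) 0 → Matrix (Fin 2) (Fin 2) ℂ} (τ : PBond (F.P K) 0 → ℂ)
    (hS : ∀ b, S b ∈ skewAdjoint (Matrix (Fin 2) (Fin 2) ℂ)) (hS0 : ∀ b, (S b).trace = 0)
    (hT : ∀ b, T b ∈ skewAdjoint (Matrix (Fin 2) (Fin 2) ℂ)) (hT0 : ∀ b, (T b).trace = 0) :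
    ‖DstarL2 F n K c₀ W (toL2 F K c₀ (fun b => S b + Complex.I • T b + τ b • (1 : Matrix (Fin 2) (Fin 2) ℂ)))‖ ^ 2
      = ‖DstarL2 F n K c₀ W (toL2 F K c₀ S)‖ ^ 2 + ‖DstarL2 F n K c₀ W (toL2 F K c₀ T)‖ ^ 2
        + ‖DstarL2 F n K c₀ W (toL2 F K c₀ (fun b => τ b • (1 : Matrix (Fin 2) (Fin 2) ℂ)))‖ ^ 2 := by
  have hS' : ∀ b, star (S b) = -S b ∧ (S b).trace = 0 := fun b => ⟨skewAdjoint.mem_iff.1 (hS b), hS0 b⟩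
  have hT' : ∀ b, star (T b) = -T b ∧ (T b).trace = 0 := fun b => ⟨skewAdjoint.mem_iff.1 (hT b), hT0 b⟩
  rw [norm_sq_DstarL2_toL2_eq F n K c₀ W, norm_sq_DstarL2_toL2_eq F n K c₀ W S, norm_sq_DstarL2_toL2_eq F n K c₀ W T,
    norm_sq_DstarL2_toL2_eq F n K c₀ W (fun b => τ b • (1 : Matrix (Fin 2) (Fin 2) ℂ)), ← mul_add, ← mul_add, ← Finset.sum_add_distrib, ← Finset.sum_add_distrib]
  congr 1
  exact Finset.sum_congr rfl fun x _ => sum_normSq_divB_entries_sectors_member F W S T hS' hT' τ x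

end Rows

/-! ## §2 ★★ `hHsplit` for the door's letter `H f := c₀L·ℓ²·CURL_HS f + ‖D*_W f‖²` -/

/-- ★★ **THE DOOR'S `H` IS SECTOR-ADDITIVE, HENCE `hHsplit` HOLDS** — the hypothesis `hHsplit` of ✓`Prop7QH1OfSectors.hQH1_of_sectors` at
`H F n K W f := c₀ F.L·((F.L:ℝ)^(K−n))²·CURL_HS_W(toL2⁻¹ f) + ‖D*_W f‖²` (`CURL_HS` in the engine's `curl (torusT) (unitsField (toUField W))` letters of
✓`Prop7EngOfTrueAvgBudget.curlHS_le_re_inner_DeltaEtaSlot`), with EQUALITY (§1).  USE: `hQH1_of_sectors c₀ cB H hH0 (hHsplit_doorH c₀) h𝔰𝔲 hcen`.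
[cite: Balaban1985BackgroundPropagators, (3.4) p.391, (3.8)–(3.11) p.392; Balaban1985Variational, (14) p.280] -/
theorem hHsplit_doorH (c₀ : ℕ → ℝ) [hc₀ : ∀ L : ℕ, Fact (0 < c₀ L)]
    (F : T3Family) (n K : ℕ) (W : GaugeField (F.P K) 0 (Matrix.specialUnitaryGroup (Fin 2) ℂ))
    (S T : PBond (F.P K) 0 → Matrix (Fin 2) (Fin 2) ℂ) (τ : PBond (F.P K) 0 → ℂ)
    (hS : ∀ b, S b ∈ skewAdjoint (Matrix (Fin 2) (Fin 2) ℂ)) (hS0 : ∀ b, (S b).trace = 0)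
    (hT : ∀ b, T b ∈ skewAdjoint (Matrix (Fin 2) (Fin 2) ℂ)) (hT0 : ∀ b, (T b).trace = 0) :
    (fun (F : T3Family) (n K : ℕ) (W : GaugeField (F.P K) 0 (Matrix.specialUnitaryGroup (Fin 2) ℂ)) (f : BondL2K ℂ 3 (periodsT3 F K) (c₀ F.L) W₂) =>
        c₀ F.L * ((F.L : ℝ) ^ (K - n)) ^ 2 * (∑ x : Site (F.P K) 0, ∑ μ : Fin (F.P K).d, ∑ ν : Fin (F.P K).d,
            (if μ < ν then ∑ j : Fin 2, ∑ k : Fin 2,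
              ‖(curl (torusT (F.P K) 0) (fun κ z => unitsField (toUField W) ⟨z, κ⟩) (fun κ z => (toL2 F K (c₀ F.L)).symm f ⟨z, κ⟩) μ ν x) j k‖ ^ 2 else 0))
          + ‖DstarL2 F n K (c₀ F.L) W f‖ ^ 2) F n K W (toL2 F K (c₀ F.L) S)
      + (fun (F : T3Family) (n K : ℕ) (W : GaugeField (F.P K) 0 (Matrix.specialUnitaryGroup (Fin 2) ℂ)) (f : BondL2K ℂ 3 (periodsT3 F K) (c₀ F.L) W₂) =>
        c₀ F.L * ((F.L : ℝ) ^ (K - n)) ^ 2 * (∑ x : Site (F.P K) 0, ∑ μ : Fin (F.P K).d, ∑ ν : Fin (F.P K).d,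
            (if μ < ν then ∑ j : Fin 2, ∑ k : Fin 2,
              ‖(curl (torusT (F.P K) 0) (fun κ z => unitsField (toUField W) ⟨z, κ⟩) (fun κ z => (toL2 F K (c₀ F.L)).symm f ⟨z, κ⟩) μ ν x) j k‖ ^ 2 else 0))
          + ‖DstarL2 F n K (c₀ F.L) W f‖ ^ 2) F n K W (toL2 F K (c₀ F.L) T)
      + (fun (F : T3Family) (n K : ℕ) (W : GaugeField (F.P K) 0 (Matrix.specialUnitaryGroup (Fin 2) ℂ)) (f : BondL2K ℂ 3 (periodsT3 F K) (c₀ F.L) W₂) =>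
        c₀ F.L * ((F.L : ℝ) ^ (K - n)) ^ 2 * (∑ x : Site (F.P K) 0, ∑ μ : Fin (F.P K).d, ∑ ν : Fin (F.P K).d,
            (if μ < ν then ∑ j : Fin 2, ∑ k : Fin 2,
              ‖(curl (torusT (F.P K) 0) (fun κ z => unitsField (toUField W) ⟨z, κ⟩) (fun κ z => (toL2 F K (c₀ F.L)).symm f ⟨z, κ⟩) μ ν x) j k‖ ^ 2 else 0))
          + ‖DstarL2 F n K (c₀ F.L) W f‖ ^ 2) F n K W (toL2 F K (c₀ F.L) (fun b => τ b • (1 : Matrix (Fin 2) (Fin 2) ℂ)))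
    ≤ (fun (F : T3Family) (n K : ℕ) (W : GaugeField (F.P K) 0 (Matrix.specialUnitaryGroup (Fin 2) ℂ)) (f : BondL2K ℂ 3 (periodsT3 F K) (c₀ F.L) W₂) =>
        c₀ F.L * ((F.L : ℝ) ^ (K - n)) ^ 2 * (∑ x : Site (F.P K) 0, ∑ μ : Fin (F.P K).d, ∑ ν : Fin (F.P K).d,
            (if μ < ν then ∑ j : Fin 2, ∑ k : Fin 2,
              ‖(curl (torusT (F.P K) 0) (fun κ z => unitsField (toUField W) ⟨z, κ⟩) (fun κ z => (toL2 F K (c₀ F.L)).symm f ⟨z, κ⟩) μ ν x) j k‖ ^ 2 else 0))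
          + ‖DstarL2 F n K (c₀ F.L) W f‖ ^ 2) F n K W (toL2 F K (c₀ F.L) (fun b => S b + Complex.I • T b + τ b • (1 : Matrix (Fin 2) (Fin 2) ℂ))) := by
  simp only [LinearEquiv.symm_apply_apply]
  rw [curlHS_sector_split_member W τ hS hS0 hT hT0, normSq_DstarL2_sector_split (n := n) (c₀ := c₀ F.L) W τ hS hS0 hT hT0]
  apply le_of_eq
  ring

/-- **THE DOOR'S `H` IS NON-NEGATIVE** — the `hH0` letter of the EX display ∕ ✓`hQH1_of_sectors` at the same `H` (a sum of squares). [cite: Balaban1985BackgroundPropagators, (3.10)–(3.11) p.392] -/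
theorem hH0_doorH (c₀ : ℕ → ℝ) [hc₀ : ∀ L : ℕ, Fact (0 < c₀ L)] :
    ∀ (F : T3Family) (n K : ℕ) (W : GaugeField (F.P K) 0 (Matrix.specialUnitaryGroup (Fin 2) ℂ)) (f : BondL2K ℂ 3 (periodsT3 F K) (c₀ F.L) W₂),
      0 ≤ (fun (F : T3Family) (n K : ℕ) (W : GaugeField (F.P K) 0 (Matrix.specialUnitaryGroup (Fin 2) ℂ)) (f : BondL2K ℂ 3 (periodsT3 F K) (c₀ F.L) W₂) =>
        c₀ F.L * ((F.L : ℝ) ^ (K - n)) ^ 2 * (∑ x : Site (F.P K) 0, ∑ μ : Fin (F.P K).d, ∑ ν : Fin (F.P K).d,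
            (if μ < ν then ∑ j : Fin 2, ∑ k : Fin 2,
              ‖(curl (torusT (F.P K) 0) (fun κ z => unitsField (toUField W) ⟨z, κ⟩) (fun κ z => (toL2 F K (c₀ F.L)).symm f ⟨z, κ⟩) μ ν x) j k‖ ^ 2 else 0))
          + ‖DstarL2 F n K (c₀ F.L) W f‖ ^ 2) F n K W f := by
  intro F n K W f
  have hc : 0 < c₀ F.L := (hc₀ F.L).out
  refine add_nonneg (mul_nonneg (mul_nonneg hc.le (sq_nonneg _)) ?_) (sq_nonneg _)
  refine Finset.sum_nonneg fun x _ => Finset.sum_nonneg fun μ _ => Finset.sum_nonneg fun ν _ => ?_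
  split_ifs
  · exact Finset.sum_nonneg fun j _ => Finset.sum_nonneg fun k _ => sq_nonneg _
  · exact le_rfl

/-- **THE DOOR'S `H` ON A ROUTE ONE-FORM, IN THE LANE'S LATTICE CURRENCIES**: `H_door F n K W (toL2 A) = c₀L·ℓ²·(CURL_HS_W(A) + DIV_HS_W(A))` — the `(toL2)⁻¹(toL2 A)` redex reduced and
`‖D*_W (toL2 A)‖² = c₀L·ℓ²·DIV_HS_W(A)` (✓`norm_sq_DstarL2_toL2_eq`); the reading the `h𝔰𝔲`∕`hcen` suppliers' right-hand sides (`ℓ²·(CURL_HS + DIV_HS)`) meet.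
[cite: Balaban1985BackgroundPropagators, (3.8)–(3.11) p.392] -/
theorem doorH_toL2_eq (c₀ : ℕ → ℝ) [hc₀ : ∀ L : ℕ, Fact (0 < c₀ L)]
    (F : T3Family) (n K : ℕ) (W : GaugeField (F.P K) 0 (Matrix.specialUnitaryGroup (Fin 2) ℂ)) (A : PBond (F.P K) 0 → Matrix (Fin 2) (Fin 2) ℂ) :
    (fun (F : T3Family) (n K : ℕ) (W : GaugeField (F.P K) 0 (Matrix.specialUnitaryGroup (Fin 2) ℂ)) (f : BondL2K ℂ 3 (periodsT3 F K) (c₀ F.L) W₂) =>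
        c₀ F.L * ((F.L : ℝ) ^ (K - n)) ^ 2 * (∑ x : Site (F.P K) 0, ∑ μ : Fin (F.P K).d, ∑ ν : Fin (F.P K).d,
            (if μ < ν then ∑ j : Fin 2, ∑ k : Fin 2,
              ‖(curl (torusT (F.P K) 0) (fun κ z => unitsField (toUField W) ⟨z, κ⟩) (fun κ z => (toL2 F K (c₀ F.L)).symm f ⟨z, κ⟩) μ ν x) j k‖ ^ 2 else 0))
          + ‖DstarL2 F n K (c₀ F.L) W f‖ ^ 2) F n K W (toL2 F K (c₀ F.L) A)
      = c₀ F.L * ((F.L : ℝ) ^ (K - n)) ^ 2 *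
          ((∑ x : Site (F.P K) 0, ∑ μ : Fin (F.P K).d, ∑ ν : Fin (F.P K).d,
              (if μ < ν then ∑ j : Fin 2, ∑ k : Fin 2,
                ‖(curl (torusT (F.P K) 0) (fun κ z => unitsField (toUField W) ⟨z, κ⟩) (fun κ z => A ⟨z, κ⟩) μ ν x) j k‖ ^ 2 else 0))
            + ∑ x : Site (F.P K) 0, ∑ j : Fin 2, ∑ k : Fin 2,
                ‖(divB (torusT (F.P K) 0) (fun κ z => unitsField (toUField W) ⟨z, κ⟩) (fun κ z => A ⟨z, κ⟩) x) j k‖ ^ 2) := by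
  simp only [LinearEquiv.symm_apply_apply]
  rw [norm_sq_DstarL2_toL2_eq F n K (c₀ F.L) W A]
  ring

end Summit.QuantumFields.YangMills.Theorems.Prop7QH1SectorRowsOfH

end
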